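import Literature.Geometry.Lorentzian.BackgroundChartCalculusFramed
import Literature.Geometry.Lorentzian.TameChartCompactness
import HarnessLib

/-!
# Local Cheeger–Gromov compactness relative to a framed background

Twin of `TameChartCompactness.lean` with pinching and `Cᵏ` bounds measured on the FRAMED deviations
`h̃ₙ = A⁻¹^*(Ψₙ^* gₙ) − η` (`Spacetime.framedDeviation 𝔉 Ψₙ`) for a smooth frame field `𝔉` with
smooth inverse on the connected open chart domain `O` (`NearFramedChart.lean`). Conclusion: a
near-framed limit field `G = A^*(η + h̃)` on `O` (`NearFramedChart O 𝔉`: smooth, Lorentzian,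
`‖A⁻¹^*G − η‖ ≤ θ`, inheriting the framed `Cᵏ` bounds), `C^∞_loc` convergence of the framed
deviations, and `(𝓢ₙ, pₙ) ⇀ ((O, G, A⁻¹∂₀), y₀)` in the pointed `Cᵏ_loc` sense for every `k`
(`Spacetime.exists_nearFramedChart_subconvergesLocallyTo`). With the identity frame this is the
near-Minkowski theorem; with the Kerr–Schild frame `A = I + Hℓ⊗ηℓ` on `Kerr.region a r₀` it gives
ETERNAL SINGLE-CHART LIMITS DOWN TO THE HORIZON for spacetimes uniformly close to Kerr–Schild Kerr
there (no gluing needed for globally presented sources).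

The datum (`LocalSubconvergence.ofChartsFramed`) is `ofCharts` with orienting field `A⁻¹∂₀`.

## References
* P. Petersen, *Riemannian Geometry*, 2nd ed., GTM 171, Springer 2006, Ch. 10, §3.2. [Petersen2006]
-/

noncomputable section

open Set Metric Filter Topology Function TopologicalSpace
open scoped Manifold ContDiff Topology ENNReal

universe u

namespace Literature.Geometry.Lorentzian

namespace Spacetime

namespace LocalSubconvergence

variable {𝓢ₙ : ℕ → Spacetime.{u} 4} {pₙ : ∀ n, (𝓢ₙ n).carrier} {O : Opens E4} {𝔉 : FrameField O}

/-- **The subconvergence datum defined by converging charts pinched in a frame** (twin of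
`ofCharts`; orienting field of the limit `A⁻¹∂₀`). [cite: Petersen2006, Ch. 10 §3.2] -/
def ofChartsFramed (hO : IsConnected (O : Set E4)) {y₀ : E4} (hy₀ : y₀ ∈ (O : Set E4))
    (Ψ : ∀ n, O → (𝓢ₙ n).carrier) (hΨ : ∀ n, ContMDiff 𝓘(ℝ, E4) (𝓡 4) ∞ (Ψ n))
    (hinj : ∀ n, Injective (Ψ n)) (hcentre : ∀ n, Ψ n ⟨y₀, hy₀⟩ = pₙ n)
    (hfut : ∀ n, (𝓢ₙ n).timeOrientation.IsFutureDirected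
      (mfderiv 𝓘(ℝ, E4) (𝓡 4) (Ψ n) ⟨y₀, hy₀⟩ (𝔉.Ainv y₀ (E4.basisVector 0))))
    (hpinch : ∀ n, ∀ y ∈ (O : Set E4), ‖(𝓢ₙ n).framedDeviation 𝔉 (Ψ n) ⟨y₀, hy₀⟩ y‖ < 1)
    (L : NearFramedChart O 𝔉) {φ : ℕ → ℕ} (hφ : StrictMono φ) (k : ℕ)
    (hlim : ∀ K ⊆ (O : Set E4), IsCompact K →
      Tendsto (fun m ↦ supCkENorm K k
        ((𝓢ₙ (φ m)).metricInCoords (Ψ (φ m) ∘ (chartAt E4 (⟨y₀, hy₀⟩ : O)).symm) - L.G))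
        atTop (𝓝 0)) :
    LocalSubconvergence 𝓢ₙ pₙ (L.spacetime hO) ⟨y₀, hy₀⟩ k where
  sub := φ
  strictMono_sub := hφ
  U := reflOpens (L.spacetime hO) ⟨y₀, hy₀⟩
  monotone_U _ _ hmn _ hx :=
    interior_mono ((compactExhaustion (L.spacetime hO)).subset (Nat.add_le_add_right hmn _)) hx
  mem_U := (compactExhaustion (L.spacetime hO)).subset_interior (by omega)
    ((compactExhaustion (L.spacetime hO)).mem_find _)
  iUnion_U := eq_univ_of_forall fun x ↦ mem_iUnion.2
    ⟨(compactExhaustion (L.spacetime hO)).find x + 1,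
      (compactExhaustion (L.spacetime hO)).subset_interior (by omega)
        ((compactExhaustion (L.spacetime hO)).mem_find x)⟩
  isCompact_closure_U _ :=
    ((compactExhaustion (L.spacetime hO)).isCompact _).closure_of_subset interior_subset
  embed m := Ψ (φ m)
  isLocalDiffeomorphOn_embed m :=
    ((𝓢ₙ (φ m)).isLocalDiffeomorph_of_norm_framedDeviation_lt_one 𝔉 (Ψ (φ m)) (hΨ _) ⟨y₀, hy₀⟩
      (hpinch _)).isLocalDiffeomorphOn _
  injOn_embed m := (hinj (φ m)).injOn
  embed_basepoint m := hcentre (φ m)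
  isFutureDirected_mfderiv_embed m x _ :=
    (𝓢ₙ (φ m)).isFutureDirected_mfderiv_Ainv_basisVector_zero_of_norm_framedDeviation_lt_one 𝔉
      hO.isPreconnected (Ψ (φ m)) (hΨ _) ⟨y₀, hy₀⟩ (hpinch _) (hfut (φ m)) x
  tendsto_supCkENorm x K hK hKt := by
    have hKO : K ⊆ (O : Set E4) := by
      have h : (chartAt E4 x).target = (O : Set E4) := OpensChart.chartAt_target x
      exact hKt.trans h.subset
    have heq : ∀ m, supCkENorm K k
        ((𝓢ₙ (φ m)).metricInCoords (Ψ (φ m) ∘ (chartAt E4 x).symm) -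
          (L.spacetime hO).metricInCoords (chartAt E4 x).symm) =
        supCkENorm K k ((𝓢ₙ (φ m)).metricInCoords (Ψ (φ m) ∘ (chartAt E4 (⟨y₀, hy₀⟩ : O)).symm)
          - L.G) := fun m ↦ by
      refine supCkENorm_congr fun y hy ↦ ?_
      filter_upwards [O.2.mem_nhds (hKO hy)] with z hz
      have h1 : (L.spacetime hO).metricInCoords (chartAt E4 x).symm z = L.G z :=
        L.metricInCoords_chartAt_symm_eqOn hO x hz
      show (𝓢ₙ (φ m)).metricInCoords (Ψ (φ m) ∘ (chartAt E4 (⟨y₀, hy₀⟩ : O)).symm) z -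
          (L.spacetime hO).metricInCoords (chartAt E4 x).symm z =
        (𝓢ₙ (φ m)).metricInCoords (Ψ (φ m) ∘ (chartAt E4 (⟨y₀, hy₀⟩ : O)).symm) z - L.G z
      rw [h1]
    exact (hlim K hKO hK).congr fun m ↦ (heq m).symm

end LocalSubconvergence

variable {𝓢ₙ : ℕ → Spacetime.{u} 4} {pₙ : ∀ n, (𝓢ₙ n).carrier} {O : Opens E4} {𝔉 : FrameField O}

/-- Framed deviations of smooth charts are smooth on `O`. [folklore] -/
theorem contDiffOn_framedDeviation (𝓢 : Spacetime.{u} 4) (Ψ : O → 𝓢.carrier)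
    (hΨ : ContMDiff 𝓘(ℝ, E4) (𝓡 4) ∞ Ψ) (x₀ : O) :
    ContDiffOn ℝ ∞ (𝓢.framedDeviation 𝔉 Ψ x₀) O :=
  (ContDiffOn.framedBilin (𝓢.contDiffOn_metricInCoords O.2
    (𝓢.contMDiffOn_comp_chartAt_symm (Minkowski.backgroundOn O) Ψ x₀ hΨ)) 𝔉.contDiffOn_Ainv).sub
    contDiffOn_const

/-- **Local Cheeger–Gromov compactness relative to a framed background, locally bounded form**:
charts pinched in the frame UNIFORMLY on `O` (`‖h̃ₙ‖ ≤ θ < 1`) whose framed deviations have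
derivatives of every order bounded on every compact `K ⊆ O` uniformly in `n` have a subsequence
whose framed deviations converge in every `Cᵏ_loc(O)` to `L.framed.G − η`, whose components
converge to `L.G` in every `Cᵏ_loc(O)`, and the near-framed chart spacetime `L.spacetime` is a
pointed `Cᵏ_loc` limit for every `k`. [cite: Petersen2006, Ch. 10 §3.2] -/
theorem exists_nearFramedChart_subconvergesLocallyTo_of_locallyBounded
    (hO : IsConnected (O : Set E4)) {y₀ : E4}
    (hy₀ : y₀ ∈ (O : Set E4)) (Ψ : ∀ n, O → (𝓢ₙ n).carrier)
    (hΨ : ∀ n, ContMDiff 𝓘(ℝ, E4) (𝓡 4) ∞ (Ψ n)) (hinj : ∀ n, Injective (Ψ n))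
    (hcentre : ∀ n, Ψ n ⟨y₀, hy₀⟩ = pₙ n)
    (hfut : ∀ n, (𝓢ₙ n).timeOrientation.IsFutureDirected
      (mfderiv 𝓘(ℝ, E4) (𝓡 4) (Ψ n) ⟨y₀, hy₀⟩ (𝔉.Ainv y₀ (E4.basisVector 0))))
    {θ : ℝ} (hθ : θ < 1)
    (hpinch : ∀ n, ∀ y ∈ (O : Set E4), ‖(𝓢ₙ n).framedDeviation 𝔉 (Ψ n) ⟨y₀, hy₀⟩ y‖ ≤ θ)
    (hb : ∀ (i : ℕ), ∀ K ⊆ (O : Set E4), IsCompact K → ∃ Λ : ℝ, ∀ n, ∀ z ∈ K,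
      ‖iteratedFDeriv ℝ i ((𝓢ₙ n).framedDeviation 𝔉 (Ψ n) ⟨y₀, hy₀⟩) z‖ ≤ Λ) :
    ∃ (L : NearFramedChart O 𝔉) (φ : ℕ → ℕ), StrictMono φ ∧
      (∀ y ∈ (O : Set E4), ‖L.framed.G y - Minkowski.bilin‖ ≤ θ) ∧
      (∀ (k : ℕ), ∀ K ⊆ (O : Set E4), IsCompact K →
        Tendsto (fun j ↦ supCkENorm K k
          ((𝓢ₙ (φ j)).framedDeviation 𝔉 (Ψ (φ j)) ⟨y₀, hy₀⟩ - (L.framed.G - fun _ ↦ Minkowski.bilin)))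
          atTop (𝓝 0)) ∧
      (∀ (k : ℕ), ∀ K ⊆ (O : Set E4), IsCompact K →
        Tendsto (fun j ↦ supCkENorm K k
          ((𝓢ₙ (φ j)).metricInCoords (Ψ (φ j) ∘ (chartAt E4 (⟨y₀, hy₀⟩ : O)).symm) - L.G))
          atTop (𝓝 0)) ∧
      ∀ k : ℕ, SubconvergesLocallyTo 𝓢ₙ pₙ (L.spacetime hO) ⟨y₀, hy₀⟩ k := by
  let z₀ : O := ⟨y₀, hy₀⟩
  let B : ModelBackground := Minkowski.backgroundOn O
  let M : ℕ → E4 → E4 →L[ℝ] E4 →L[ℝ] ℝ := fun n ↦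
    (𝓢ₙ n).metricInCoords (Ψ n ∘ (chartAt E4 z₀).symm)
  let H : ℕ → E4 → E4 →L[ℝ] E4 →L[ℝ] ℝ := fun n ↦ (𝓢ₙ n).framedDeviation 𝔉 (Ψ n) z₀
  have hHdef : ∀ n, H n = framedBilin (M n) 𝔉.Ainv - fun _ ↦ Minkowski.bilin := fun _ ↦ rfl
  have hMs : ∀ n, ContDiffOn ℝ ∞ (M n) O := fun n ↦
    (𝓢ₙ n).contDiffOn_metricInCoords O.2 ((𝓢ₙ n).contMDiffOn_comp_chartAt_symm B (Ψ n) z₀ (hΨ n))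
  have hHs : ∀ n, ContDiffOn ℝ ∞ (H n) O := fun n ↦
    (ContDiffOn.framedBilin (hMs n) 𝔉.contDiffOn_Ainv).sub contDiffOn_const
  obtain ⟨Hlim, φ, hφ, hHlim, hconv, hpt⟩ :=
    exists_strictMono_contDiffOn_infty_tendsto_supCkENorm_sub O.2 hHs hb
  -- the framed limit `F̃ = Hlim + η` and the limit field `G = A^* F̃`
  let Ft : E4 → E4 →L[ℝ] E4 →L[ℝ] ℝ := fun y ↦ Hlim y + Minkowski.bilin
  let G : E4 → E4 →L[ℝ] E4 →L[ℝ] ℝ := framedBilin Ft 𝔉.A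
  have hFts : ContDiffOn ℝ ∞ Ft O := hHlim.add contDiffOn_const
  have hGs : ContDiffOn ℝ ∞ G O := ContDiffOn.framedBilin hFts 𝔉.contDiffOn_A
  have hFtsub : ∀ y, Ft y - Minkowski.bilin = Hlim y := fun y ↦ by
    ext v w
    simp only [Ft, sub_apply, add_apply]
    ring
  have hHsymm : ∀ n, ∀ y (v w : E4), H n y v w = H n y w v := fun n y v w ↦ by
    simp only [hHdef, Pi.sub_apply, sub_apply]
    rw [framedBilin_symm 𝔉.Ainv (fun a b ↦ (𝓢ₙ n).metricInCoords_symm _ y a b) v w,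
      Minkowski.bilin_symm v w]
  have hFtsymm : ∀ y ∈ (O : Set E4), ∀ v w : E4, Ft y v w = Ft y w v := fun y hy v w ↦ by
    have h := symm_of_tendsto_bilin (hpt y hy) (fun j ↦ hHsymm (φ j) y) v w
    simp only [Ft, add_apply]
    rw [h, Minkowski.bilin_symm v w]
  have hGsymm : ∀ y ∈ (O : Set E4), ∀ v w : E4, G y v w = G y w v := fun y hy v w ↦
    framedBilin_symm 𝔉.A (hFtsymm y hy) v w
  have hFtpinch : ∀ y ∈ (O : Set E4), ‖Ft y - Minkowski.bilin‖ ≤ θ := by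
    intro y hy
    rw [hFtsub y]
    exact norm_le_of_tendsto_bilin (hpt y hy) fun j ↦ hpinch (φ j) y hy
  -- `A⁻¹^* G = F̃` on `O`
  have hframedG : ∀ y ∈ (O : Set E4), framedBilin G 𝔉.Ainv y = Ft y := fun y hy ↦
    𝔉.framedBilin_A_Ainv Ft hy
  let L : NearFramedChart O 𝔉 :=
    { G := G
      contDiffOn := hGs
      symm := hGsymm
      norm_framed_sub_lt := fun y hy ↦ by rw [hframedG y hy]; exact (hFtpinch y hy).trans_lt hθ }
  have hLfr : ∀ y ∈ (O : Set E4), L.framed.G y = Ft y := hframedG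
  -- framed-deviation convergence and inherited bounds (statements about `L.framed.G − η = Hlim` on `O`)
  have hgerm : ∀ y ∈ (O : Set E4), (L.framed.G - fun _ ↦ Minkowski.bilin) =ᶠ[𝓝 y] Hlim := by
    intro y hy
    filter_upwards [O.2.mem_nhds hy] with z hz
    rw [Pi.sub_apply, hLfr z hz, hFtsub z]
  have hconvDev : ∀ (k : ℕ), ∀ K ⊆ (O : Set E4), IsCompact K →
      Tendsto (fun j ↦ supCkENorm K k (H (φ j) - (L.framed.G - fun _ ↦ Minkowski.bilin))) atTop
        (𝓝 0) := by
    intro k K hKO hK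
    refine (hconv k K hKO hK).congr fun j ↦ supCkENorm_congr fun y hy ↦ ?_
    exact EventuallyEq.rfl.sub (hgerm y (hKO hy)).symm
  -- convergence of the COMPONENTS: `M (φ j) − G = A^*(H (φ j) − Hlim)` on `O`
  have hMG : ∀ y ∈ (O : Set E4), ∀ j (v w : E4),
      (M (φ j) - G) y v w = framedBilin (H (φ j) - Hlim) 𝔉.A y v w := by
    intro y hy j v w
    have hA1 : 𝔉.Ainv y (𝔉.A y v) = v := 𝔉.Ainv_A_apply hy v
    have hA2 : 𝔉.Ainv y (𝔉.A y w) = w := 𝔉.Ainv_A_apply hy w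
    have hH : H (φ j) y (𝔉.A y v) (𝔉.A y w) =
        M (φ j) y v w - Minkowski.bilin (𝔉.A y v) (𝔉.A y w) := by
      rw [hHdef, Pi.sub_apply, sub_apply, sub_apply, framedBilin_apply, hA1, hA2]
    show M (φ j) y v w - framedBilin Ft 𝔉.A y v w = framedBilin (H (φ j) - Hlim) 𝔉.A y v w
    rw [framedBilin_apply, framedBilin_apply, Pi.sub_apply, sub_apply, sub_apply, hH]
    show M (φ j) y v w - (Hlim y + Minkowski.bilin) (𝔉.A y v) (𝔉.A y w) =
      M (φ j) y v w - Minkowski.bilin (𝔉.A y v) (𝔉.A y w) - Hlim y (𝔉.A y v) (𝔉.A y w)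
    rw [add_apply, add_apply]
    ring
  have hconvG : ∀ (k : ℕ), ∀ K ⊆ (O : Set E4), IsCompact K →
      Tendsto (fun j ↦ supCkENorm K k (M (φ j) - G)) atTop (𝓝 0) := by
    intro k K hKO hK
    have h := tendsto_supCkENorm_framedBilin (l := atTop) O.2
      (𝔉.contDiffOn_A.of_le (by exact_mod_cast le_top)) hK hKO
      (F := fun j ↦ H (φ j) - Hlim)
      (Eventually.of_forall fun j ↦ ⟨O, O.2, hKO,
        ((hHs (φ j)).sub hHlim).of_le (by exact_mod_cast le_top)⟩)
      (hconv k K hKO hK)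
    refine h.congr fun j ↦ supCkENorm_congr fun y hy ↦ ?_
    filter_upwards [O.2.mem_nhds (hKO hy)] with z hz
    ext v w
    exact (hMG z hz j v w).symm
  refine ⟨L, φ, hφ, fun y hy ↦ by rw [hLfr y hy]; exact hFtpinch y hy, hconvDev, hconvG,
    fun k ↦ ?_⟩
  exact ⟨LocalSubconvergence.ofChartsFramed hO hy₀ Ψ hΨ hinj hcentre hfut
    (fun n y hy ↦ (hpinch n y hy).trans_lt hθ) L hφ k (hconvG k)⟩

/-- **Local Cheeger–Gromov compactness relative to a framed background** (module docstring):
a framed-pinched sequence of charts with framed deviations bounded in every `Cᵏ(O)` has a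
subsequence whose framed deviations converge in every `Cᵏ_loc(O)` to `L.framed.G − η` (which
inherits the bounds), whose components converge to `L.G`, and the near-framed chart spacetime
`L.spacetime` is a pointed `Cᵏ_loc` limit for every `k`. [cite: Petersen2006, Ch. 10 §3.2] -/
theorem exists_nearFramedChart_subconvergesLocallyTo (hO : IsConnected (O : Set E4)) {y₀ : E4}
    (hy₀ : y₀ ∈ (O : Set E4)) (Ψ : ∀ n, O → (𝓢ₙ n).carrier)
    (hΨ : ∀ n, ContMDiff 𝓘(ℝ, E4) (𝓡 4) ∞ (Ψ n)) (hinj : ∀ n, Injective (Ψ n))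
    (hcentre : ∀ n, Ψ n ⟨y₀, hy₀⟩ = pₙ n)
    (hfut : ∀ n, (𝓢ₙ n).timeOrientation.IsFutureDirected
      (mfderiv 𝓘(ℝ, E4) (𝓡 4) (Ψ n) ⟨y₀, hy₀⟩ (𝔉.Ainv y₀ (E4.basisVector 0))))
    {θ : ℝ} (hθ : θ < 1)
    (hpinch : ∀ n, ∀ y ∈ (O : Set E4), ‖(𝓢ₙ n).framedDeviation 𝔉 (Ψ n) ⟨y₀, hy₀⟩ y‖ ≤ θ)
    (hbound : ∀ k : ℕ, ∃ Λ : ℝ≥0∞, Λ ≠ ⊤ ∧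
      ∀ n, supCkENorm (O : Set E4) k ((𝓢ₙ n).framedDeviation 𝔉 (Ψ n) ⟨y₀, hy₀⟩) ≤ Λ) :
    ∃ (L : NearFramedChart O 𝔉) (φ : ℕ → ℕ), StrictMono φ ∧
      (∀ y ∈ (O : Set E4), ‖L.framed.G y - Minkowski.bilin‖ ≤ θ) ∧
      (∀ (k : ℕ) (C : ℝ≥0∞), (∀ n, supCkENorm (O : Set E4) k
          ((𝓢ₙ n).framedDeviation 𝔉 (Ψ n) ⟨y₀, hy₀⟩) ≤ C) →
        supCkENorm (O : Set E4) k (L.framed.G - fun _ ↦ Minkowski.bilin) ≤ C) ∧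
      (∀ (k : ℕ), ∀ K ⊆ (O : Set E4), IsCompact K →
        Tendsto (fun j ↦ supCkENorm K k
          ((𝓢ₙ (φ j)).framedDeviation 𝔉 (Ψ (φ j)) ⟨y₀, hy₀⟩ - (L.framed.G - fun _ ↦ Minkowski.bilin)))
          atTop (𝓝 0)) ∧
      (∀ (k : ℕ), ∀ K ⊆ (O : Set E4), IsCompact K →
        Tendsto (fun j ↦ supCkENorm K k
          ((𝓢ₙ (φ j)).metricInCoords (Ψ (φ j) ∘ (chartAt E4 (⟨y₀, hy₀⟩ : O)).symm) - L.G))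
          atTop (𝓝 0)) ∧
      ∀ k : ℕ, SubconvergesLocallyTo 𝓢ₙ pₙ (L.spacetime hO) ⟨y₀, hy₀⟩ k := by
  let H : ℕ → E4 → E4 →L[ℝ] E4 →L[ℝ] ℝ := fun n ↦ (𝓢ₙ n).framedDeviation 𝔉 (Ψ n) ⟨y₀, hy₀⟩
  have hHs : ∀ n, ContDiffOn ℝ ∞ (H n) O := fun n ↦
    contDiffOn_framedDeviation (𝓢ₙ n) (Ψ n) (hΨ n) ⟨y₀, hy₀⟩
  -- uniform bounds on every derivative on `O`, a fortiori on compacts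
  have hb : ∀ (i : ℕ), ∀ K ⊆ (O : Set E4), IsCompact K →
      ∃ Λ : ℝ, ∀ n, ∀ z ∈ K, ‖iteratedFDeriv ℝ i (H n) z‖ ≤ Λ := by
    intro i K hKO _
    obtain ⟨Λ, hΛ, hΛb⟩ := hbound i
    refine ⟨Λ.toReal, fun n z hz ↦ ?_⟩
    exact (norm_iteratedFDeriv_le_toReal_supCkENorm le_rfl (hKO hz) (H n)
      (ne_top_of_le_ne_top hΛ (hΛb n))).trans (ENNReal.toReal_mono hΛ (hΛb n))
  obtain ⟨L, φ, hφ, hGpinch, hconvDev, hconvG, hsub⟩ :=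
    exists_nearFramedChart_subconvergesLocallyTo_of_locallyBounded hO hy₀ Ψ hΨ hinj hcentre hfut hθ
      hpinch hb
  refine ⟨L, φ, hφ, hGpinch, fun k C hC ↦ ?_, hconvDev, hconvG, hsub⟩
  -- the limit inherits the global bounds: pointwise limits of the derivatives
  have hLs : ContDiffOn ℝ ∞ (L.framed.G - fun _ ↦ Minkowski.bilin) O :=
    L.framed.contDiffOn.sub contDiffOn_const
  refine supCkENorm_le_of_forall_le fun m hm z hz ↦ ?_
  have ht : Tendsto (fun j ↦ iteratedFDeriv ℝ m (H (φ j)) z) atTop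
      (𝓝 (iteratedFDeriv ℝ m (L.framed.G - fun _ ↦ Minkowski.bilin) z)) :=
    tendsto_iteratedFDeriv_of_tendsto_supCkENorm hm (mem_singleton z)
      (fun j ↦ ((hHs (φ j)).of_le (by exact_mod_cast le_top)).contDiffAt (O.2.mem_nhds hz))
      ((hLs.of_le (by exact_mod_cast le_top)).contDiffAt (O.2.mem_nhds hz))
      (hconvDev k {z} (singleton_subset_iff.2 hz) isCompact_singleton)
  refine le_of_tendsto' ((continuous_enorm.tendsto _).comp ht) fun j ↦ ?_
  exact (enorm_iteratedFDeriv_le_supCkENorm hm hz _).trans (hC (φ j))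

end Spacetime


end Literature.Geometry.Lorentzian

end
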